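import Summits.Ventures.CertifiedManyBodySolver.Observables.PairLROTowerStationary
import Summits.Ventures.CertifiedManyBodySolver.Observables.RungLeavesPairLROTTPrimeOnePoint
import HarnessLib

/-!
# OP1-S, reading step: the space-group-averaged equation-of-motion term, the orbit-state form of the
# theorem, and the `t′`-generic summit-format leaf

HONEST FRAMING: first certified bounds on pairing observables; not a superconductivity verdict; a ceiling
route, never presence; every number certified (two lineages + referee) or labelled float. Crew hubbard-obs
(D-0042), seat hubbard-obs-p1 (`prover-hubbard-obs-p1-g6-0`). Zero compute; no definition; no named fact;
no `sorry`.

The OP1-S claim nodes will be typed, like the OP1-E nodes (`Certificates/…obsOP1E…`), in ORBIT-STATE form over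
the space-group family `(U_w D_γ)_{w ∈ (ℤ/L)², γ ∈ S}`: the certificate identity read in `ω̄_ζ` for every unit
`ζ`, now with the equation-of-motion term `Re ω̄_ζ(H_L Γ_L X − Γ_L X H_L)`, `X ∈ 𝔄_{Λ'}` the combined neutral
eom word of the certificate. This file supplies the dictionary to the plain form consumed by
`liminf_pairFieldLRO_le_sq_of_onePoint_stationary_bound_TT'` (PairLROTowerStationary):

* `orbitState_spaceGroupUnitary_commutator_fermionEmbed` — `ω̄_ζ([H_L, Γ_L X]) = |S|⁻¹ Σ_{γ∈S} L⁻² ⟨ζ, [H_L, W_γ] ζ⟩`,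
  `W_γ = Σ_v T_v Γ_{L,γΛ'}(Γ(d4Emb γ 0) X)` the translation sum of the rotated word (`D_γ` commutes with `H_L`;
  `D_γ Γ_L X D_γᴴ = Γ_{L,γΛ'}(Γ(d4Emb γ 0) X)`; the translation average of `[H_L, Y]` is `L⁻²⟨[H_L, Σ_v T_v Y]⟩`);
* `sum_translate_spaceGroupAverage_eq` — `|S|⁻¹ Σ_γ W_γ = Σ_v T_v Γ_{L,Ω}(X_S)` with `Ω = ⋃_γ γΛ'` and the single
  number-conserving local word `X_S = |S|⁻¹ Σ_γ Γ(incl)(Γ(d4Emb γ 0) X) ∈ 𝔄_Ω`;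
* **`liminf_pairFieldLRO_le_sq_of_onePoint_stationary_orbitState_bound_TT'`** — (OP1-S) in orbit-state form
  for a point group `S ≠ ∅` fixing the form factor ⇒ `liminf_k u_k ≤ M²`;
* **`M3ObsPairLROCeilingAt_of_onePoint_stationary_orbitState_bound_sq`** — the registry consumer at
  `(U, n) = (8, 7/8)`, any `t′`: leaf `M3ObsPairLROCeilingAt tp c'` at every `c' ≥ M²` (the node shape of an
  OP1-S certificate: that of the OP1-E node plus the eom term, `X` carried explicitly).

References: T. Koma, H. Tasaki, J. Stat. Phys. 76 (1994) 745, Theorem 5 [KomaTasaki1994]; X. Han,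
arXiv:2006.06002, §2–3 [Han2020Bootstrap]; O. Bratteli, D. W. Robinson, *Operator Algebras and Quantum
Statistical Mechanics 2* (1997), §6.2.4 [BratteliRobinsonII1997]; W. Pusz, S. L. Woronowicz, Comm. Math.
Phys. 58 (1978) 273, §1 [PuszWoronowicz1978].
-/

noncomputable section

namespace Summit.Ventures.CertifiedManyBodySolver.Observables

open Matrix Complex Finset Literature.MathematicalPhysics.QuantumLattice Literature.Probability.LatticeModels
open Literature.MathematicalPhysics.QuantumLattice.HubbardWave0 ThermodynamicLimit Filter Topology
open Literature.MathematicalPhysics.QuantumManyBody.StateRelaxation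
open Summit.Ventures.CertifiedManyBodySolver.Transport
open scoped ComplexOrder ComplexConjugate BigOperators

/-! ### §1  The space-group average of an equation-of-motion term -/

section Reading

variable {L : ℕ} [NeZero L]

/-- `expect` is additive over finite sums. [folklore] -/
private theorem expect_finset_sum' {ι κ : Type*} [LinearOrder ι] [Fintype ι] (s : Finset κ)
    (f : κ → Matrix (Finset ι) (Finset ι) ℂ) (ψ : Fock ι) :
    expect (∑ k ∈ s, f k) ψ = ∑ k ∈ s, expect (f k) ψ := by
  unfold Literature.MathematicalPhysics.QuantumLattice.expect
  rw [Matrix.sum_mulVec, dotProduct_sum]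

/-- `⟨Mᴴφ, A Mᴴφ⟩ = ⟨φ, (M A Mᴴ) φ⟩`. [folklore] -/
private theorem expect_conjTranspose_mulVec'' {ι : Type*} [LinearOrder ι] [Fintype ι]
    (A M : Matrix (Finset ι) (Finset ι) ℂ) (φ : Fock ι) :
    expect A (Mᴴ *ᵥ φ) = expect (M * A * Mᴴ) φ := by
  unfold Literature.MathematicalPhysics.QuantumLattice.expect
  rw [star_mulVec, conjTranspose_conjTranspose, ← dotProduct_mulVec, mulVec_mulVec, mulVec_mulVec]

/-- **The space-group-averaged orbit state of an equation-of-motion term.** For a finite `S ⊆ D₄`, a window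
`Λ'` fitting into the torus, `X ∈ 𝔄_{Λ'}`, `H_L = hubbardTorusTT' L t t' U` and any torus vector `ζ`:
`ω̄_ζ(H_L Γ_L X − Γ_L X H_L) = |S|⁻¹ Σ_{γ∈S} L⁻² ⟨ζ, (H_L W_γ − W_γ H_L) ζ⟩`, `W_γ = Σ_v T_v Γ_{L,γΛ'}(Γ(d4Emb γ 0 Λ') X)`.
[cite: BratteliRobinsonII1997, §6.2.4] [cite: Han2020Bootstrap, §3] -/
theorem orbitState_spaceGroupUnitary_commutator_fermionEmbed (S : Finset (DihedralGroup 4)) (t t' U : ℝ)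
    {Λ' : Finset (Site 2)} (hInj' : Set.InjOn (Torus.proj (d := 2) L) ↑Λ') (X : FermionOp Λ')
    (ζ : Fock (Orb (FermionTorus 2 L))) :
    orbitState (spaceGroupUnitary S) ζ
        (hubbardTorusTT' L t t' U * fermionEmbed (PolySite.toTorusEmb L hInj') X -
          fermionEmbed (PolySite.toTorusEmb L hInj') X * hubbardTorusTT' L t t' U) =
      (S.card : ℂ)⁻¹ * ∑ γ ∈ S, ((Fintype.card (TorusSite 2 L) : ℂ))⁻¹ *
        expect (hubbardTorusTT' L t t' U *
            (∑ v : TorusSite 2 L, relabel (Orb.translate v)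
              (fermionEmbed (PolySite.toTorusEmb L ((injOn_proj_d4ShiftSet_iff L γ 0 Λ').2 hInj'))
                (fermionEmbed (PolySite.d4Emb γ 0 Λ') X))) -
          (∑ v : TorusSite 2 L, relabel (Orb.translate v)
              (fermionEmbed (PolySite.toTorusEmb L ((injOn_proj_d4ShiftSet_iff L γ 0 Λ').2 hInj'))
                (fermionEmbed (PolySite.d4Emb γ 0 Λ') X))) * hubbardTorusTT' L t t' U) ζ := by
  set H := hubbardTorusTT' L t t' U with hH
  set Y := fermionEmbed (PolySite.toTorusEmb L hInj') X with hY
  rw [orbitState_spaceGroupUnitary_eq_sum_expect_conj S]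
  refine congrArg _ (Finset.sum_congr rfl fun γ _ => ?_)
  refine congrArg _ ?_
  have hInjγ : Set.InjOn (Torus.proj (d := 2) L) ↑(d4ShiftSet γ 0 Λ') :=
    (injOn_proj_d4ShiftSet_iff L γ 0 Λ').2 hInj'
  set D := (fockD4 (L := L) γ).val with hD
  set Yγ := fermionEmbed (PolySite.toTorusEmb L hInjγ) (fermionEmbed (PolySite.d4Emb γ 0 Λ') X) with hYγ
  -- `D Y Dᴴ = Y_γ` and `D` commutes with `H`
  have hDY : D * Y * Dᴴ = Yγ := by
    have hproj0 : Torus.proj L (0 : Site 2) = 0 := by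
      funext i
      simp [Torus.proj]
    rw [hYγ, fermionEmbed_toTorusEmb_d4Emb γ 0 hInj' hInjγ X, hproj0, Orb.translate_zero, Equiv.Perm.one_def,
      relabel_refl, relabel_eq_fockRelabel_conj, hD, hY, fockD4_apply]
  have hDH : D * H = H * D := (fockD4_commute_hubbardTorusTT' (L := L) γ t t' U).eq
  have hHherm : Hᴴ = H := (hubbardTorusTT'_isHermitian L t t' U).eq
  have hDH' : H * Dᴴ = Dᴴ * H := by
    have h := congrArg conjTranspose hDH
    rw [conjTranspose_mul, conjTranspose_mul, hHherm] at h
    exact h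
  have h1 : D * (H * Y) * Dᴴ = H * (D * Y * Dᴴ) := by
    rw [← Matrix.mul_assoc D H Y, hDH, Matrix.mul_assoc H D Y, Matrix.mul_assoc H (D * Y) Dᴴ]
  have h2 : D * (Y * H) * Dᴴ = (D * Y * Dᴴ) * H := by
    rw [← Matrix.mul_assoc D Y H, Matrix.mul_assoc (D * Y) H Dᴴ, hDH', ← Matrix.mul_assoc (D * Y) Dᴴ H]
  have hconj : D * (H * Y - Y * H) * Dᴴ = H * Yγ - Yγ * H := by
    rw [Matrix.mul_sub, Matrix.sub_mul, h1, h2, hDY]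
  simp_rw [hconj]
  -- the translation average of `[H, Y_γ]` is `⟨ζ, [H, Σ_v T_v Y_γ] ζ⟩`
  have hstep : ∀ v : TorusSite 2 L, expect (H * Yγ - Yγ * H) ((fockTranslate v).val *ᵥ ζ) =
      expect (H * relabel (Orb.translate (-v)) Yγ - relabel (Orb.translate (-v)) Yγ * H) ζ := by
    intro v
    rw [expect_fockRelabel_mulVec, ← Equiv.Perm.inv_def, ← Orb.translate_neg, relabel_sub, relabel_mul,
      relabel_mul, relabel_translate_hubbardTorusTT']
  simp_rw [hstep]
  rw [← expect_finset_sum']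
  congr 1
  rw [Finset.mul_sum, Finset.sum_mul, ← Finset.sum_sub_distrib]
  exact Fintype.sum_equiv (Equiv.neg (TorusSite 2 L)) _ _ fun v => rfl

/-- **The space-group average of the rotated translation sums is ONE translation sum** of the symmetrised
word: with `Ω ⊇ γΛ'` for all `γ ∈ S` (fitting into the torus),
`Σ_{γ∈S} W_γ = Σ_v T_v Γ_{L,Ω}(Σ_{γ∈S} Γ(incl)(Γ(d4Emb γ 0 Λ') X))`. [cite: BratteliRobinsonII1997, §6.2.4] -/
theorem sum_translate_spaceGroupAverage_eq (S : Finset (DihedralGroup 4)) {Λ' Ω : Finset (Site 2)}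
    (hInj' : Set.InjOn (Torus.proj (d := 2) L) ↑Λ') (hΩ : Set.InjOn (Torus.proj (d := 2) L) ↑Ω)
    (hsub : ∀ γ ∈ S, d4ShiftSet γ 0 Λ' ⊆ Ω) (X : FermionOp Λ') :
    ∑ γ ∈ S, (∑ v : TorusSite 2 L, relabel (Orb.translate v)
        (fermionEmbed (PolySite.toTorusEmb L ((injOn_proj_d4ShiftSet_iff L γ 0 Λ').2 hInj'))
          (fermionEmbed (PolySite.d4Emb γ 0 Λ') X))) =
      ∑ v : TorusSite 2 L, relabel (Orb.translate v) (fermionEmbed (PolySite.toTorusEmb L hΩ)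
        (∑ γ ∈ S.attach, fermionEmbed (PolySite.incl (hsub γ.1 γ.2)) (fermionEmbed (PolySite.d4Emb γ.1 0 Λ') X))) := by
  rw [Finset.sum_comm]
  refine Finset.sum_congr rfl fun v _ => ?_
  rw [fermionEmbed_sum, relabel_sum, ← Finset.sum_attach S]
  refine Finset.sum_congr rfl fun γ _ => ?_
  rw [fermionEmbed_toTorusEmb_incl (hsub γ.1 γ.2) hΩ]

end Reading

/-! ### §2  (OP1-S) in orbit-state form ⇒ `liminf u_k ≤ M²` -/

section Family

variable (g : Site 2 → ℝ)

/-- **Orbit-state form of OP1-S, sharp constant.** As `liminf_pairFieldLRO_le_sq_of_onePoint_orbitState_bound_TT'`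
(point group `S ≠ ∅` on which the form factor is invariant, window `Λ' ⊇ pairRegion {0,±e₁,±e₂} 0` fitting the tori
of side `≥ L₁`), with `0 < n` and ONE more datum: a number-conserving word `X ∈ 𝔄_{Λ'}` (`[N̂_{Λ'}, X] = 0`) whose
equation-of-motion term `Re ω̄_ζ(H_L Γ_L X − Γ_L X H_L)` is ADDED to the left-hand side of the one-point bound.
Conclusion unchanged: `liminf_k u_k ≤ (c − A + (Σμ)(n/2 − ν))²`.
[cite: KomaTasaki1994, Theorem 5] [cite: Han2020Bootstrap, §2–3] [cite: PuszWoronowicz1978, §1] -/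
theorem liminf_pairFieldLRO_le_sq_of_onePoint_stationary_orbitState_bound_TT' (t t' : ℝ) {U n : ℝ}
    (hU : 0 ≤ U) (hn0 : 0 < n) (hn2 : n < 2) {c A κ u ν : ℝ} (μ : Fin 2 → ℝ) (hκ : 0 ≤ κ)
    (hu : energyDensityTT' t t' U n ≤ u)
    {S : Finset (DihedralGroup 4)} (hS : S.Nonempty)
    (hg : ∀ γ ∈ S, ∀ e ∈ insert (0 : Site 2) unitSteps, g (d4Vec γ e) = g e)
    {Λ' : Finset (Site 2)} (h0 : pairRegion (insert (0 : Site 2) unitSteps) 0 ⊆ Λ')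
    (X : FermionOp Λ') (hXN : Commute totalNumberOp X) (L₁ : ℕ)
    (hInj : ∀ L : ℕ, L₁ ≤ L → Set.InjOn (Torus.proj (d := 2) L) ↑Λ')
    (hbound : ∀ (L : ℕ) [NeZero L] (hL : L₁ ≤ L) (ζ : Fock (Orb (FermionTorus 2 L))), star ζ ⬝ᵥ ζ = 1 →
      c - A + ∑ σ : Fin 2, μ σ *
          ((star ζ ⬝ᵥ ((∑ y : FermionTorus 2 L, numberOp y σ) *ᵥ ζ)).re / (L : ℝ) ^ 2 - ν) +
        κ * (u - (star ζ ⬝ᵥ (hubbardTorusTT' L t t' U *ᵥ ζ)).re / (L : ℝ) ^ 2) +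
        (orbitState (spaceGroupUnitary S) ζ
          (hubbardTorusTT' L t t' U * fermionEmbed (PolySite.toTorusEmb L (hInj L hL)) X -
            fermionEmbed (PolySite.toTorusEmb L (hInj L hL)) X * hubbardTorusTT' L t t' U)).re ≤
        (orbitState (spaceGroupUnitary S) ζ (fermionEmbed (PolySite.toTorusEmb L (hInj L hL))
          (-(fermionEmbed (PolySite.incl h0) (localPairAt (insert (0 : Site 2) unitSteps) g 0))))).re)
    (ψ : ∀ L, Fock (Orb (FermionTorus 2 L)))
    (hψ : ∀ L, IsGroundStateInSector (hubbardTorusTT' L t t' U) (rectN n L) 0 (ψ L))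
    (hψ1 : ∀ L, star (ψ L) ⬝ᵥ ψ L = 1) :
    liminf (fun k : ℕ => (∑ x ∈ halfOpenBox 2 (2 * k), ∑ y ∈ halfOpenBox 2 (2 * k),
        torusPullback (pairFieldCorr g ψ) (2 * k) x y) / ((#(halfOpenBox 2 (2 * k)) : ℝ)) ^ 2) atTop ≤
      (c - A + (∑ σ : Fin 2, μ σ) * (n / 2 - ν)) ^ 2 := by
  -- the symmetrised eom word on `Ω = ⋃_γ γΛ'`
  set Ω : Finset (Site 2) := S.biUnion (fun γ => d4ShiftSet γ 0 Λ') with hΩdef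
  have hsub : ∀ γ ∈ S, d4ShiftSet γ 0 Λ' ⊆ Ω := fun γ hγ =>
    Finset.subset_biUnion_of_mem (fun γ => d4ShiftSet γ 0 Λ') hγ
  set XS : FermionOp Ω := ((S.card : ℂ))⁻¹ •
    ∑ γ ∈ S.attach, fermionEmbed (PolySite.incl (hsub γ.1 γ.2)) (fermionEmbed (PolySite.d4Emb γ.1 0 Λ') X)
    with hXS
  have hXSN : Commute totalNumberOp XS := by
    refine Commute.smul_right (Commute.sum_right _ _ _ fun γ _ => ?_) _
    exact commute_totalNumberOp_fermionEmbed _ (commute_totalNumberOp_fermionEmbed _ hXN)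
  obtain ⟨LΩ, hLΩ⟩ := exists_forall_le_injOn_proj (d := 2) Ω
  have hInjΩ : ∀ L : ℕ, max L₁ LΩ ≤ L → Set.InjOn (Torus.proj (d := 2) L) ↑Ω :=
    fun L hL => hLΩ L (le_trans (le_max_right _ _) hL)
  refine liminf_pairFieldLRO_le_sq_of_onePoint_stationary_bound_TT' g t t' hU hn0 hn2 μ hκ hu XS hXSN
    (max L₁ LΩ) hInjΩ ?_ ψ hψ hψ1
  intro L _ hL ζ hζ
  have hL₁ : L₁ ≤ L := le_trans (le_max_left _ _) hL
  have hcardS : (S.card : ℂ) ≠ 0 := Nat.cast_ne_zero.2 (Finset.card_pos.2 hS).ne'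
  have hcardT : (Fintype.card (TorusSite 2 L) : ℂ) = (((L : ℝ) ^ 2 : ℝ) : ℂ) := by
    have hc : Fintype.card (TorusSite 2 L) = L ^ 2 := by simp [ZMod.card, Fintype.card_fin]
    rw [hc]; push_cast; ring
  -- identify the averaged eom term with the single translation sum of `XS`
  have hW : ∑ v : TorusSite 2 L, relabel (Orb.translate v) (fermionEmbed (PolySite.toTorusEmb L (hInjΩ L hL)) XS) =
      ((S.card : ℂ))⁻¹ • ∑ γ ∈ S, (∑ v : TorusSite 2 L, relabel (Orb.translate v)
        (fermionEmbed (PolySite.toTorusEmb L ((injOn_proj_d4ShiftSet_iff L γ 0 Λ').2 (hInj L hL₁)))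
          (fermionEmbed (PolySite.d4Emb γ 0 Λ') X))) := by
    rw [sum_translate_spaceGroupAverage_eq S (hInj L hL₁) (hInjΩ L hL) hsub X, hXS]
    simp_rw [fermionEmbed_smul, relabel_smul]
    rw [← Finset.smul_sum]
  have hsumexp : ∑ γ ∈ S, expect (hubbardTorusTT' L t t' U *
      (∑ v : TorusSite 2 L, relabel (Orb.translate v)
        (fermionEmbed (PolySite.toTorusEmb L ((injOn_proj_d4ShiftSet_iff L γ 0 Λ').2 (hInj L hL₁)))
          (fermionEmbed (PolySite.d4Emb γ 0 Λ') X))) -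
      (∑ v : TorusSite 2 L, relabel (Orb.translate v)
        (fermionEmbed (PolySite.toTorusEmb L ((injOn_proj_d4ShiftSet_iff L γ 0 Λ').2 (hInj L hL₁)))
          (fermionEmbed (PolySite.d4Emb γ 0 Λ') X))) * hubbardTorusTT' L t t' U) ζ =
      (S.card : ℂ) * expect (hubbardTorusTT' L t t' U *
        (∑ v : TorusSite 2 L, relabel (Orb.translate v) (fermionEmbed (PolySite.toTorusEmb L (hInjΩ L hL)) XS)) -
        (∑ v : TorusSite 2 L, relabel (Orb.translate v) (fermionEmbed (PolySite.toTorusEmb L (hInjΩ L hL)) XS)) *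
          hubbardTorusTT' L t t' U) ζ := by
    rw [hW, Matrix.mul_smul, Matrix.smul_mul, ← smul_sub, Finset.mul_sum, Finset.sum_mul, ← Finset.sum_sub_distrib]
    unfold Literature.MathematicalPhysics.QuantumLattice.expect
    rw [smul_mulVec, dotProduct_smul, smul_eq_mul, ← mul_assoc, mul_inv_cancel₀ hcardS, one_mul,
      Matrix.sum_mulVec, dotProduct_sum]
  -- the space-group-averaged eom term is the plain eom term of the translation sum of `XS`
  have heom : (orbitState (spaceGroupUnitary S) ζ
      (hubbardTorusTT' L t t' U * fermionEmbed (PolySite.toTorusEmb L (hInj L hL₁)) X -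
        fermionEmbed (PolySite.toTorusEmb L (hInj L hL₁)) X * hubbardTorusTT' L t t' U)).re =
      (star ζ ⬝ᵥ ((hubbardTorusTT' L t t' U *
        (∑ v : TorusSite 2 L, relabel (Orb.translate v) (fermionEmbed (PolySite.toTorusEmb L (hInjΩ L hL)) XS)) -
        (∑ v : TorusSite 2 L, relabel (Orb.translate v) (fermionEmbed (PolySite.toTorusEmb L (hInjΩ L hL)) XS)) *
          hubbardTorusTT' L t t' U) *ᵥ ζ)).re / (L : ℝ) ^ 2 := by
    rw [orbitState_spaceGroupUnitary_commutator_fermionEmbed S t t' U (hInj L hL₁) X ζ, ← Finset.mul_sum, hsumexp,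
      mul_left_comm, inv_mul_cancel_left₀ hcardS, hcardT, ← Complex.ofReal_inv, Complex.re_ofReal_mul,
      inv_mul_eq_div]
    rfl
  have h := hbound L hL₁ ζ hζ
  rw [fermionEmbed_neg, map_neg, Complex.neg_re,
    re_orbitState_spaceGroupUnitary_localPairAt g hS hg h0 (hInj L hL₁) ζ, heom] at h
  exact h

/-- **Registry consumer, orbit-state form of OP1-S at the M3 points `(U, n) = (8, 7/8)`, any `t′`, SHARP constant.**
Hypotheses of `M3ObsPairLROCeilingAt_of_onePoint_orbitState_bound_sq` (RungLeavesPairLROTTPrimeOnePoint: the OP1-E node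
shape — cap node `M3EnergyUpperRow tp hi`, `hi ≤ u`, `κ ≥ 0`, point group `S ≠ ∅` with `b1gSign = 1`, window
`Λ' ⊇ pairRegion {0,±e₁,±e₂} 0` fitting the tori of side `≥ L₁`) PLUS the eom word `X ∈ 𝔄_{Λ'}` with `[N̂_{Λ'}, X] = 0`
and its term `Re ω̄_ζ(H^{1,tp}_L Γ_L X − Γ_L X H^{1,tp}_L)` on the left of the claimed inequality (THE NODE SHAPE OF AN
OP1-S CERTIFICATE). Conclusion: `M3ObsPairLROCeilingAt tp c'` at every rational `c' ≥ (c − A + (Σ_σ μ_σ)(7/16 − ν))²`.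
CONDITIONAL ON THE CLAIM NODE fed in; a ceiling never speaks to presence. [cite: KomaTasaki1994, Theorem 5]
[cite: Han2020Bootstrap, §2–3] -/
theorem M3ObsPairLROCeilingAt_of_onePoint_stationary_orbitState_bound_sq {tp : ℝ} {hi c' : ℚ} {c A κ u ν : ℝ}
    (μ : Fin 2 → ℝ) (hκ : 0 ≤ κ) (hE : M3EnergyUpperRow tp hi) (hhi : ((hi : ℚ) : ℝ) ≤ u)
    {S : Finset (DihedralGroup 4)} (hS : S.Nonempty) (hS1 : ∀ γ ∈ S, b1gSign γ = 1)
    {Λ' : Finset (Site 2)} (h0 : pairRegion (insert (0 : Site 2) unitSteps) 0 ⊆ Λ')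
    (X : FermionOp Λ') (hXN : Commute totalNumberOp X) (L₁ : ℕ)
    (hInj : ∀ L : ℕ, L₁ ≤ L → Set.InjOn (Torus.proj (d := 2) L) ↑Λ')
    (hbound : ∀ (L : ℕ) [NeZero L] (hL : L₁ ≤ L) (ζ : Fock (Orb (FermionTorus 2 L))), star ζ ⬝ᵥ ζ = 1 →
      c - A + ∑ σ : Fin 2, μ σ *
          ((star ζ ⬝ᵥ ((∑ y : FermionTorus 2 L, numberOp y σ) *ᵥ ζ)).re / (L : ℝ) ^ 2 - ν) +
        κ * (u - (star ζ ⬝ᵥ (hubbardTorusTT' L 1 tp 8 *ᵥ ζ)).re / (L : ℝ) ^ 2) +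
        (orbitState (spaceGroupUnitary S) ζ
          (hubbardTorusTT' L 1 tp 8 * fermionEmbed (PolySite.toTorusEmb L (hInj L hL)) X -
            fermionEmbed (PolySite.toTorusEmb L (hInj L hL)) X * hubbardTorusTT' L 1 tp 8)).re ≤
        (orbitState (spaceGroupUnitary S) ζ (fermionEmbed (PolySite.toTorusEmb L (hInj L hL))
          (-(fermionEmbed (PolySite.incl h0)
            (localPairAt (insert (0 : Site 2) unitSteps) dWaveFormFactor 0))))).re)
    (hc' : (c - A + (∑ σ : Fin 2, μ σ) * ((7 / 8 : ℝ) / 2 - ν)) ^ 2 ≤ ((c' : ℚ) : ℝ)) :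
    M3ObsPairLROCeilingAt tp c' := by
  intro ψ hψ hψ1
  have hu : energyDensityTT' 1 tp 8 (7 / 8) ≤ u :=
    (show energyDensityTT' 1 tp 8 (7 / 8) ≤ ((hi : ℚ) : ℝ) from hE).trans hhi
  have hg : ∀ γ ∈ S, ∀ e ∈ insert (0 : Site 2) unitSteps, dWaveFormFactor (d4Vec γ e) = dWaveFormFactor e :=
    fun γ hγ e _ => dWaveFormFactor_d4Vec_of_b1gSign_eq_one (hS1 γ hγ) e
  exact (liminf_pairFieldLRO_le_sq_of_onePoint_stationary_orbitState_bound_TT' dWaveFormFactor 1 tp (by norm_num)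
    (by norm_num) (by norm_num) μ hκ hu hS hg h0 X hXN L₁ hInj hbound ψ hψ hψ1).trans hc'

end Family

end Summit.Ventures.CertifiedManyBodySolver.Observables

end
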